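import Summits.HodgeConjecture.HodgeConjecture.Theorems.MarkmanPartnerTransportLowPicardRMCellsKappa

/-!
# Route MarkmanPartnerTransport · crux #5 `LowPicardRealMultiplication` — «CELL-SEED»: a Bloch-semiregular seed for
# `κ_θ` on a cell closes the cell (the seed road T3′ read cell-wise)

Programme «RM-GEN + CELL-SPLIT» (planner p1 g38/g39, chapter P1AL «algebraic source for κ_θ»), X-side twin of the
K3-side «K3-SR» (`…PicardThreeK3SquaresSemiregularSeed`, prover 19716-p2 g7). Route-independent (no `Theses` import;
notations copied verbatim from `…LowPicardRMCells` / `…LowPicardRMCellsKappa`). On the cell `(ρ(X), [E:ℚ]) = (ρ, d)` of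
crux #5 the RM generator `θ` of «RM-GEN» (`RMgen[X, φ, z, d]`) has ONE explicit class `κ_θ` whose algebraicity is
exactly HC⁴ on the cell (`cellHC_iff_cellKappa`). `CellSeed[ρ, d]` TYPES the one missing input as the seed package of
T3′ (`OrphanSR.hodgeConjectureFor_of_endomorphismField_of_semiregularSeed`): for every `X` in the cell and every `θ`
carrying the `RMgen` data, a smooth projective family `f : 𝒳 → B` (quasi-projective total space, smooth
quasi-projective base, `B(ℂ)` connected) through `X ≅ 𝒳_{t₁}` and some `X₀ ≅ 𝒳_{s₀}`, a global class
`W ∈ H⁴(𝒳(ℂ); ℂ)` fibrewise rational of type `(2,2)` with `W|_X ≡ κ_θ (mod A²(X))`, and `W|_{X₀}` supported on an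
integral Bloch-SEMIREGULAR local complete intersection surface `Z ⊂ X₀`:

* `cellKappa_of_cellSeed` — `CellSeed[ρ, d] → CellKappa[ρ, d]` modulo ONLY {Bloch 1972 / Buchweitz–Flenner 2003 Thm.
  5.2} (`BlochSemiregularSpread 4 2`): Bloch spread near `s₀`, Baire spread over `B(ℂ)` (Charles–Schnell, tree theorem
  `algebraicLocusClosed`), transport along `e₁` (`OrphanSR.kappaClass_mem_algebraicClasses_of_semiregularSeed`);
* `cellHC_of_cellSeed` — **`CellSeed[ρ, d] → CellHC[ρ, d]`** modulo {Bloch/BF, Verbitsky–Guan, O'Grady 2008,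
  Charles–Markman 2013} (`cellHC_of_cellKappa`); NO Kuga–Satake.

So each open cell `(2,3), (2,7), (3,4), (3,5)` has three typed roads in the tree: (KS) void there, (κ) `κ_θ ∈ A²(X)`,
(SR) one semiregular seed for `κ_θ` per member (where a Hecke/CM seed of chapter P1AL would enter). CONDITIONAL on the
named facts and on the seed packages (no instance known in print); no definition, no sorry; credits nothing to the
Hodge conjecture. Prover seat hodge-nonav-20241-p1 (gen 14), `--supports stmt-HodgeConjecture-19653`.

References: S. Bloch, Invent. Math. 17 (1972) Thm. 7.4; R.-O. Buchweitz, H. Flenner, Compositio Math. 137 (2003)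
Thm. 5.2; F. Charles, C. Schnell, arXiv:1010.4422 Thm. 1; E. Markman, JEMS (2024) §1.1 Thm. 1.1.
-/

noncomputable section

set_option linter.dupNamespace false

open Module CategoryTheory MonoidalCategory AlgebraicGeometry
open Literature.AlgebraicTopology.SingularHomology Literature.Geometry.Kaehler
open Literature.AlgebraicGeometry Literature.AlgebraicGeometry.Motives Literature.AlgebraicGeometry.HodgeTheory
open Literature.AlgebraicGeometry.Hyperkaehler Literature.AlgebraicGeometry.Surfaces
open Summit.HodgeConjecture.HodgeConjecture.Theorems.NikulinTwinTransport
open Summit.HodgeConjecture.HodgeConjecture.Theorems.MarkmanPartnerTransport.BBFPositivity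

namespace Summit.HodgeConjecture.HodgeConjecture.Theorems.MarkmanPartnerTransport.PartnerLattice

/-- `MarkedK3Sq[X, φ, P, z]`: VERBATIM the `let MarkedK3Sq := …` binder of the route declarations of
MarkmanPartnerTransport (clauses (m1)–(m6)). Local notation only. -/
local notation3 (prettyPrint := false) "MarkedK3Sq[" X ", " φ ", " P ", " z "]" =>
  (((IsIntegralClass P ∧ ∀ Q : complexBetti X (2 * 4), IsIntegralClass Q → ∃ n : ℤ, Q = n • P) ∧
    (∀ c : complexBetti X 2, IsIntegralClass c ↔ ∃ v : K3HilbertIndex → ℤ, φ c = fun i => (v i : ℂ)) ∧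
    (∀ a : complexBetti X 2, cupPowTwo a 4 = ((3 : ℂ) * (k3HilbertForm 2 (φ a) (φ a)) ^ 2) • P) ∧
    (IsOfHodgeType 4 X 2 2 0 (LinearEquiv.symm φ z) ∧
      ∀ τ : complexBetti X 2, IsOfHodgeType 4 X 2 2 0 τ → ∃ t : ℂ, τ = t • LinearEquiv.symm φ z) ∧
    (∀ c : complexBetti X 2, IsOfHodgeType 4 X 2 1 1 c ↔
      (k3HilbertForm 2 (φ c) z = 0 ∧ k3HilbertForm 2 (φ c) (star z) = 0)) ∧
    (k3HilbertForm 2 z z = 0 ∧ 0 < (k3HilbertForm 2 (star z) z).re)))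

/-- `SpIso[X, φ]`: VERBATIM the `let SpannedByIsometries := …` binder of the route declarations (with
`IsBBFTransc` unfolded). Local notation only. -/
local notation3 (prettyPrint := false) "SpIso[" X ", " φ "]" =>
  (∀ f : complexBetti X 2 →ₗ[ℂ] complexBetti X 2, (∀ y, IsRationalClass y → IsRationalClass (f y)) →
    (∀ (i j : ℕ) y, IsOfHodgeType 4 X 2 i j y → IsOfHodgeType 4 X 2 i j (f y)) →
    (∀ d : complexBetti X 2, d ∈ algebraicClasses X 1 → f d = 0) →
    (∀ y : complexBetti X 2, ∀ d : complexBetti X 2, d ∈ algebraicClasses X 1 →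
      k3HilbertForm 2 (φ (f y)) (φ d) = 0) →
    ∃ (k : ℕ) (c : Fin k → ℚ) (g : Fin k → (complexBetti X 2 →ₗ[ℂ] complexBetti X 2)),
      (∀ i, Function.Bijective (g i) ∧ (∀ y, IsRationalClass y → IsRationalClass (g i y)) ∧
        (∀ (a b : ℕ) y, IsOfHodgeType 4 X 2 a b y → IsOfHodgeType 4 X 2 a b (g i y)) ∧
        (∀ a b, k3HilbertForm 2 (φ (g i a)) (φ (g i b)) = k3HilbertForm 2 (φ a) (φ b))) ∧
      ∀ y : complexBetti X 2, (∀ d : complexBetti X 2, d ∈ algebraicClasses X 1 →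
        k3HilbertForm 2 (φ y) (φ d) = 0) → f y = ∑ i : Fin k, ((c i : ℂ) • g i y))

/-- `RMgen[X, φ, z, d]` («RMgen» data, the `RMGenData` of Sketch P1AK-CELLS with self-adjointness added): a
rational, type-preserving, `q`-self-adjoint endomorphism `θ` of `H²(X(ℂ); ℂ)` with `θ σ = ev · σ`, `ev` real,
`deg minpoly_ℚ(ev) = d`, `d · n + ρ(X) = 23` for some `n ≥ 3`, and GEN: every rational type-preserving endomorphism
is `Σ_{i<d} cᵢ θⁱ` (`cᵢ ∈ ℚ`) on `T(X)_ℂ = {y : q(φ y, φ N¹(X)) = 0}`. Local notation only. -/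
local notation3 (prettyPrint := false) "RMgen[" X ", " φ ", " z ", " d "]" =>
  (∃ θ : complexBetti X 2 →ₗ[ℂ] complexBetti X 2, (∀ y, IsRationalClass y → IsRationalClass (θ y)) ∧
    (∀ (i j : ℕ) y, IsOfHodgeType 4 X 2 i j y → IsOfHodgeType 4 X 2 i j (θ y)) ∧
    (∀ y w : complexBetti X 2, k3HilbertForm 2 (φ (θ y)) (φ w) = k3HilbertForm 2 (φ y) (φ (θ w))) ∧
    ∃ ev : ℂ, θ (LinearEquiv.symm φ z) = ev • LinearEquiv.symm φ z ∧ ev.im = 0 ∧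
      (minpoly ℚ ev).natDegree = d ∧
      (∃ n : ℕ, 3 ≤ n ∧ d * n + Module.finrank ℂ ↥(algebraicClasses X 1) = 23) ∧
      ∀ f : complexBetti X 2 →ₗ[ℂ] complexBetti X 2, (∀ y, IsRationalClass y → IsRationalClass (f y)) →
        (∀ (i j : ℕ) y, IsOfHodgeType 4 X 2 i j y → IsOfHodgeType 4 X 2 i j (f y)) →
        ∃ c : Fin d → ℚ, ∀ y : complexBetti X 2,
          (∀ a : complexBetti X 2, a ∈ algebraicClasses X 1 → k3HilbertForm 2 (φ y) (φ a) = 0) →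
            f y = ∑ i : Fin d, ((c i : ℂ) • (θ ^ (i : ℕ)) y))

/-- `Kap[φ, g] = Σ_{ij} (G⁻¹)_{ij} · φ⁻¹eᵢ ∪ g(φ⁻¹eⱼ) ∈ H⁴(X(ℂ); ℂ)`, the kappa class of an endomorphism `g`
of `H²(X(ℂ); ℂ)` (VERBATIM `…K3Sq2TypeHodgeGraphClassesGeneral`). Local notation only. -/
local notation3 (prettyPrint := false) "Kap[" φ ", " g "]" =>
  (∑ i : K3HilbertIndex, ∑ j : K3HilbertIndex,
    (((k3HilbertGram 2).map (Int.cast : ℤ → ℂ))⁻¹ i j) •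
      cupProduct (rfl : 2 + 2 = 2 * 2) ((LinearEquiv.symm φ) (Pi.single i 1))
        (g ((LinearEquiv.symm φ) (Pi.single j 1))))

/-- `CellHC[ρ, d]`: **HC⁴ on the cell `(ρ(X), [E:ℚ]) = (ρ, d)`** — for every marked smooth projective `K3^{[2]}`-type
`(X, φ, P, z)` with `¬ SpannedByIsometries`, `ρ(X) = ρ` and `RMgen[X, φ, z, d]` (the `InCell`/`CellHC` of Sketch
P1AK-CELLS, curried), `HodgeConjectureFor 4 X`. Local notation only. -/
local notation3 (prettyPrint := false) "CellHC[" ρ ", " d "]" =>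
  (∀ (X : SchemeOver ℂ), IsSmoothProjective 4 X → IsOfK3HilbertSquareType X →
    ∀ (φ : complexBetti X 2 ≃ₗ[ℂ] (K3HilbertIndex → ℂ)) (P : complexBetti X (2 * 4)) (z : K3HilbertIndex → ℂ),
      MarkedK3Sq[X, φ, P, z] → ¬ SpIso[X, φ] → Module.finrank ℂ ↥(algebraicClasses X 1) = ρ →
        RMgen[X, φ, z, d] → HodgeConjectureFor 4 X)

/-- `CellKappa[ρ, d]`: **`κ_θ ∈ A²(X)` on the cell `(ρ, d)`** — for every marked smooth projective `K3^{[2]}`-type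
`(X, φ, P, z)` with `¬ SpannedByIsometries`, `ρ(X) = ρ`, and every `θ` carrying the data of `RMgen[X, φ, z, d]`, the
kappa class `κ_θ` is algebraic. Local notation only. -/
local notation3 (prettyPrint := false) "CellKappa[" ρ ", " d "]" =>
  (∀ (X : SchemeOver ℂ), IsSmoothProjective 4 X → IsOfK3HilbertSquareType X →
    ∀ (φ : complexBetti X 2 ≃ₗ[ℂ] (K3HilbertIndex → ℂ)) (P : complexBetti X (2 * 4)) (z : K3HilbertIndex → ℂ),
      MarkedK3Sq[X, φ, P, z] → ¬ SpIso[X, φ] → Module.finrank ℂ ↥(algebraicClasses X 1) = ρ →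
        ∀ θ : complexBetti X 2 →ₗ[ℂ] complexBetti X 2, (∀ y, IsRationalClass y → IsRationalClass (θ y)) →
          (∀ (i j : ℕ) y, IsOfHodgeType 4 X 2 i j y → IsOfHodgeType 4 X 2 i j (θ y)) →
          (∀ y w : complexBetti X 2, k3HilbertForm 2 (φ (θ y)) (φ w) = k3HilbertForm 2 (φ y) (φ (θ w))) →
          (∃ ev : ℂ, θ (LinearEquiv.symm φ z) = ev • LinearEquiv.symm φ z ∧ ev.im = 0 ∧
            (minpoly ℚ ev).natDegree = d ∧
            (∃ n : ℕ, 3 ≤ n ∧ d * n + Module.finrank ℂ ↥(algebraicClasses X 1) = 23) ∧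
            ∀ f : complexBetti X 2 →ₗ[ℂ] complexBetti X 2, (∀ y, IsRationalClass y → IsRationalClass (f y)) →
              (∀ (i j : ℕ) y, IsOfHodgeType 4 X 2 i j y → IsOfHodgeType 4 X 2 i j (f y)) →
              ∃ c : Fin d → ℚ, ∀ y : complexBetti X 2,
                (∀ a : complexBetti X 2, a ∈ algebraicClasses X 1 → k3HilbertForm 2 (φ y) (φ a) = 0) →
                  f y = ∑ i : Fin d, ((c i : ℂ) • (θ ^ (i : ℕ)) y)) →
          Kap[φ, θ] ∈ algebraicClasses X 2)

/-- `Res[f, s, k, A] = A|_{𝒳_s}`, restriction of a global class to the fibre over `s`. Local notation only. -/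
local notation3 (prettyPrint := false) "Res[" f ", " s ", " k ", " A "]" =>
  complexBetti.map (Motives.fiberι f s) k A

/-- `CellSeed[ρ, d]`: **a semiregular seed package for `κ_θ` on every member of the cell `(ρ, d)`** — for every marked
smooth projective `K3^{[2]}`-type `(X, φ, P, z)` with `¬ SpannedByIsometries`, `ρ(X) = ρ`, and every `θ` carrying the
data of `RMgen[X, φ, z, d]`: the seed package of T3′ (`OrphanSR.hodgeConjectureFor_of_endomorphismField_of_semiregularSeed`,
binders VERBATIM, existentially quantified). Local notation only. -/
local notation3 (prettyPrint := false) "CellSeed[" ρ ", " d "]" =>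
  (∀ (X : SchemeOver ℂ), IsSmoothProjective 4 X → IsOfK3HilbertSquareType X →
    ∀ (φ : complexBetti X 2 ≃ₗ[ℂ] (K3HilbertIndex → ℂ)) (P : complexBetti X (2 * 4)) (z : K3HilbertIndex → ℂ),
      MarkedK3Sq[X, φ, P, z] → ¬ SpIso[X, φ] → Module.finrank ℂ ↥(algebraicClasses X 1) = ρ →
        ∀ θ : complexBetti X 2 →ₗ[ℂ] complexBetti X 2, (∀ y, IsRationalClass y → IsRationalClass (θ y)) →
          (∀ (i j : ℕ) y, IsOfHodgeType 4 X 2 i j y → IsOfHodgeType 4 X 2 i j (θ y)) →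
          (∀ y w : complexBetti X 2, k3HilbertForm 2 (φ (θ y)) (φ w) = k3HilbertForm 2 (φ y) (φ (θ w))) →
          (∃ ev : ℂ, θ (LinearEquiv.symm φ z) = ev • LinearEquiv.symm φ z ∧ ev.im = 0 ∧
            (minpoly ℚ ev).natDegree = d ∧
            (∃ n : ℕ, 3 ≤ n ∧ d * n + Module.finrank ℂ ↥(algebraicClasses X 1) = 23) ∧
            ∀ f : complexBetti X 2 →ₗ[ℂ] complexBetti X 2, (∀ y, IsRationalClass y → IsRationalClass (f y)) →
              (∀ (i j : ℕ) y, IsOfHodgeType 4 X 2 i j y → IsOfHodgeType 4 X 2 i j (f y)) →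
              ∃ c : Fin d → ℚ, ∀ y : complexBetti X 2,
                (∀ a : complexBetti X 2, a ∈ algebraicClasses X 1 → k3HilbertForm 2 (φ y) (φ a) = 0) →
                  f y = ∑ i : Fin d, ((c i : ℂ) • (θ ^ (i : ℕ)) y)) →
          ∃ (X₀ : SchemeOver ℂ) (Z : Scheme.{0}) (i : Z ⟶ X₀.left) (x : complexBetti X₀ (2 * 2))
            (𝒳 B : SchemeOver ℂ) (f : 𝒳 ⟶ B) (s₀ t₁ : ComplexPoints B) (e₀ : X₀ ≅ fiberOver f s₀)
            (e₁ : X ≅ fiberOver f t₁) (W : complexBetti 𝒳 (2 * 2)),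
            IsClosedImmersion i ∧ IsRegularImmersionOfCodim i 2 ∧ AlgebraicGeometry.IsIntegral Z ∧
            (∀ z ∈ Set.range i.base, (2 : ℕ∞) ≤ Order.coheight z) ∧ IsBlochSemiregular i 4 2 ∧
            x ∈ classesSupportedOn X₀ (Set.range i.base) (2 * 2) ∧
            IsSmoothProjectiveFamily f 4 ∧ IsQuasiProjectiveOver 𝒳 ∧ IsQuasiProjectiveOver B ∧
            AlgebraicGeometry.Smooth B.hom ∧ ConnectedSpace (ComplexPoints B) ∧
            (∀ s : ComplexPoints B, IsRationalClass (Res[f, s, 2 * 2, W]) ∧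
              IsOfHodgeType 4 (fiberOver f s) (2 * 2) 2 2 (Res[f, s, 2 * 2, W])) ∧
            complexBetti.map e₀.hom (2 * 2) (Res[f, s₀, 2 * 2, W]) = x ∧
            complexBetti.map e₁.hom (2 * 2) (Res[f, t₁, 2 * 2, W]) - Kap[φ, θ] ∈ algebraicClasses X 2)

variable {ρ d : ℕ}

/-! ### A seed on every member ⟹ `κ_θ` algebraic on the cell (Bloch/BF only) -/

/-- **`CellSeed[ρ, d] → CellKappa[ρ, d]`**: a Bloch-semiregular seed package for `κ_θ` on every member of the cell
makes `κ_θ` algebraic on the cell — Bloch spread near the seed fibre, Baire spread over the connected base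
(Charles–Schnell, tree theorem), transport along `X ≅ 𝒳_{t₁}`; modulo ONLY the semiregularity theorem
`BlochSemiregularSpread 4 2`. [cite: BuchweitzFlenner2003, Thm. 5.2] [cite: Bloch1972Semiregularity, Thm. 7.4] -/
theorem cellKappa_of_cellSeed (hBl : BlochSemiregularSpread 4 2) (h : CellSeed[ρ, d]) : CellKappa[ρ, d] := by
  intro X hX hK φ P z hM hsp hρ θ h1 h2 h5 hdata
  obtain ⟨X₀, Z, i, x, 𝒳, B, f, s₀, t₁, e₀, e₁, W, hi, hreg, hZ, hcoh, hsr, hx, hf, h𝒳, hBq, hBsm, hconn, hW, hWx,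
    hWθ⟩ := h X hX hK φ P z hM hsp hρ θ h1 h2 h5 hdata
  exact OrphanSR.kappaClass_mem_algebraicClasses_of_semiregularSeed hBl θ X₀ Z i x 𝒳 B f s₀ t₁ e₀ e₁ W hi hreg hZ
    hcoh hsr hx hf h𝒳 hBq hBsm hconn hW hWx hWθ

/-! ### A seed on every member ⟹ HC⁴ on the cell -/

/-- **«CELL-SEED»: `CellSeed[ρ, d] → CellHC[ρ, d]`** — a Bloch-semiregular seed package for the kappa class `κ_θ` of
the RM generator on every member of the cell `(ρ, d)` of crux #5 gives HC⁴ on the cell (`cellKappa_of_cellSeed` +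
`cellHC_of_cellKappa`: KAPPA-IFF-ANY′ with `hgen :=` the GEN clause of `RMgen`). Modulo {Bloch/Buchweitz–Flenner,
Verbitsky–Guan, O'Grady 2008, Charles–Markman 2013}; NO Kuga–Satake; CONDITIONAL on the seed packages (no instance in
print). [cite: BuchweitzFlenner2003, Thm. 5.2] [cite: Markman2024, §1.1 Thm. 1.1] [cite: CharlesMarkman2013, Thm. 1.1 (§1)] -/
theorem cellHC_of_cellSeed (hV : VerbitskyGuan_cohomology_K3HilbertSquareType) (hO : OGrady2008_dualBBFClass_algebraic)
    (hB : CharlesMarkman2013_lefschetzStandard_K3HilbertType) (hBl : BlochSemiregularSpread 4 2) (h : CellSeed[ρ, d]) :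
    CellHC[ρ, d] :=
  cellHC_of_cellKappa hV hO hB (cellKappa_of_cellSeed hBl h)

end Summit.HodgeConjecture.HodgeConjecture.Theorems.MarkmanPartnerTransport.PartnerLattice

end
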